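import Literature.AlgebraicGeometry.ModuliOfAbelianVarieties.SiegelAdmissibleOfIsoTriple            -- ★ `isAdmissibleAt_of_isBaseChangeVia_id'` (+ ★ (U) `IsAdmissibleAt`, D4 `SiegelFineModuliScheme`)
import Literature.AlgebraicGeometry.AbelianSchemes.PolarizedAbelianSchemeWithLevelBaseChangeUnique   -- ★ L4 `IsBaseChangeVia.exists_isBaseChangeVia_id`
import Literature.AlgebraicGeometry.AbelianSchemes.PolarizedAbelianSchemeWithLevelBaseChange         -- ★ D-BC∃ `PolarizedAbelianSchemeWithLevel.exists_isBaseChangeVia`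
import HarnessLib

/-!
# Fibre triples of a Siegel fine moduli scheme: every complex point classifies a triple, and admissibility is a property
# of the classifying point ((U)-HEAD node U-e, socket P4, sub-socket P4a)

Topic `AlgebraicGeometry/ModuliOfAbelianVarieties`; namespace `Literature.AlgebraicGeometry.ModuliOfAbelianVarieties`.
Cell hodgecm-mathlib (D-0151), rung 0 of the Mumford line under `HDel` (item `stmt-HodgeConjecture-24835`), (U)-HEAD third
layer under `stub_Ue_P4`: B-p05 (g13)'s socket `UHead.Ue_P4a_fibreTriples` (`B-provers/B-p05/Ue-P4-sockets.v0.2.B-p05g13.lean`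
bf2890a49c3b659c §3), hand B-p03 (g13) (B-plan2 (g11) 2026-08-29T13:56:30Z (R-iii); B-p05 14:00:00Z (2)).  THEOREMS ONLY:
no definition, no named fact, no instance, no `sorry`.  HC_CM is proved only modulo the 7 printed citations until rung 0
closes; nothing here changes that count (a (U)-road leaf, books 0).

[MumfordFogartyKirwan1994, Ch. 7 §2 Def. 7.2–7.3, §3 Thm. 7.9]: the fine moduli scheme represents the functor of triples
`(X, λ, σ)` UP TO ISOMORPHISM; so (i) a point `x : Spec ℂ → M` IS a triple over `Spec ℂ` (the pull-back of the universal one,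
★ D-BC∃ `PolarizedAbelianSchemeWithLevel.exists_isBaseChangeVia`), classified by `x` (uniqueness in ★ D4
`SiegelFineModuliScheme.classify`), and (ii) two triples with the same classifying point are both pull-backs of the universal
triple along that point, hence isomorphic as triples (★ L4 `PolarizedAbelianSchemeWithLevel.IsBaseChangeVia.exists_isBaseChangeVia_id`,
B-p16 (g11)), and ★ (U)'s `IsAdmissibleAt hδ r Z hZ` — [Milne2005ShimuraVarieties, Thm. 6.11]: the class of `(A, s, ηK)`
depends only on the isomorphism class — transports along isomorphisms of triples (★ `isAdmissibleAt_of_isBaseChangeVia_id'`).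

* `SiegelFineModuliScheme.classifyingMap_eq_of_isBaseChangeVia` — a triple pulled back from the universal one along
  `s : T → M` is classified by `s`;
* `SiegelFineModuliScheme.exists_isBaseChangeVia_id_of_classifyingMap_eq` — **equal classifying maps ⇒ isomorphic triples**
  (`∃ H Ĥ, P'.IsBaseChangeVia P₀ (𝟙 T) H Ĥ`; the injectivity-on-isomorphism-classes half of «fine»);
* `SiegelFineModuliScheme.isAdmissibleAt_of_classifyingMap_eq` — over `Spec ℂ`: equal classifying maps ⇒ admissible at the
  same `(Z, r)`;
* `SiegelFineModuliScheme.exists_triple_isBaseChangeVia_classifyingPoint_eq` — every complex point `x` of `M ⊗_ℚ ℂ` is the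
  `ℂ`-side reading (★ `AlgPoints.baseChangeEquiv`) of the classifying map of a triple over `Spec ℂ` pulled back from the
  universal one along the `ℚ`-side reading of `x` (the witness `(G, Ĝ)` is what ★ `W1.fiberUnivIsoOfIsBaseChangeVia` eats to
  identify the abelian scheme of that triple with the fibre of the complexified universal family over `x`);
* `Ue_P4a_fibreTriples_holds` — the socket text VERBATIM (binder for binder), so the (U)-HEAD skeleton closes `stub_Ue_P4a` by
  this name.

## References
* [MumfordFogartyKirwan1994] D. Mumford, J. Fogarty, F. Kirwan, *Geometric Invariant Theory*, 3rd ed. (1994), Ch. 7 §2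
  Definition 7.2 (p. 129), Definition 7.3 (p. 129), §3 Theorem 7.9 (p. 139).
* [Milne2005ShimuraVarieties] J. S. Milne, *Introduction to Shimura Varieties* (2005), §6 Thm. 6.11 pp. 74–75.
-/

set_option autoImplicit false

noncomputable section

open CategoryTheory CategoryTheory.Limits AlgebraicGeometry
open Literature.AlgebraicGeometry.Motives (SchemeOver ComplexPoints AlgPoints specOver)
open Literature.AlgebraicGeometry.AbelianSchemes (PolarizedAbelianSchemeWithLevel)
open Literature.NumberTheory.Automorphic (siegelUpperHalfSpace)

namespace Literature.AlgebraicGeometry.ModuliOfAbelianVarieties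

namespace SiegelFineModuliScheme

variable {g N : ℕ} {δ : Fin g → ℕ} (𝓜 : SiegelFineModuliScheme g N δ)

/-! ### §1 Equal classifying maps ⇒ isomorphic triples (any locally noetherian test scheme) -/

/-- **A triple pulled back from the universal triple along `s : T → M` is classified by `s`** (uniqueness half of
★ `SiegelFineModuliScheme.classify`, = ★ `eq_classifyingMap` read from right to left).
[cite: MumfordFogartyKirwan1994, Ch. 7 §3 Theorem 7.9 (p. 139)] -/
theorem classifyingMap_eq_of_isBaseChangeVia {T : SchemeOver ℚ} [IsLocallyNoetherian T.left]
    (P' : PolarizedAbelianSchemeWithLevel g N δ T.left) (s : T ⟶ 𝓜.M)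
    {G : P'.A.X.left ⟶ 𝓜.univ.A.X.left} {Ĝ : P'.D.hat.X.left ⟶ 𝓜.univ.D.hat.X.left}
    (h : P'.IsBaseChangeVia 𝓜.univ s.left G Ĝ) :
    𝓜.classifyingMap T P' = s :=
  (𝓜.eq_classifyingMap T P' s ⟨G, Ĝ, h⟩).symm

/-- **EQUAL CLASSIFYING MAPS ⇒ ISOMORPHIC TRIPLES** ([MumfordFogartyKirwan1994] Def. 7.2–7.3: a fine moduli scheme represents
the functor of triples up to isomorphism, so it is injective on isomorphism classes): two triples over the same locally
noetherian `ℚ`-scheme `T` with the same classifying map are both pull-backs of the universal triple along it (★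
`exists_isBaseChangeVia_classifyingMap`), hence related along `𝟙 T` by the D4 relation — an isomorphism of triples (★ L4
`PolarizedAbelianSchemeWithLevel.IsBaseChangeVia.exists_isBaseChangeVia_id`).
[cite: MumfordFogartyKirwan1994, Ch. 7 §2 Definition 7.2 (p. 129) and §3 Theorem 7.9 (p. 139)] -/
theorem exists_isBaseChangeVia_id_of_classifyingMap_eq {T : SchemeOver ℚ} [IsLocallyNoetherian T.left]
    (P₀ P' : PolarizedAbelianSchemeWithLevel g N δ T.left) (hcls : 𝓜.classifyingMap T P' = 𝓜.classifyingMap T P₀) :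
    ∃ (H : P'.A.X.left ⟶ P₀.A.X.left) (Ĥ : P'.D.hat.X.left ⟶ P₀.D.hat.X.left), P'.IsBaseChangeVia P₀ (𝟙 T.left) H Ĥ := by
  obtain ⟨G₀, Ĝ₀, h₀⟩ := 𝓜.exists_isBaseChangeVia_classifyingMap T P₀
  obtain ⟨G', Ĝ', h'⟩ := 𝓜.exists_isBaseChangeVia_classifyingMap T P'
  rw [hcls] at h'
  exact h₀.exists_isBaseChangeVia_id h'

/-! ### §2 Over `Spec ℂ`: admissibility is a property of the classifying point -/

/-- **Two triples over `Spec ℂ` with the SAME classifying map are admissible at the same `(Z, r)`**: they are isomorphic as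
triples (`exists_isBaseChangeVia_id_of_classifyingMap_eq`) and ★ (U)'s `IsAdmissibleAt` transports along isomorphisms of
triples (★ `isAdmissibleAt_of_isBaseChangeVia_id'`; [Milne2005ShimuraVarieties] Thm. 6.11: the class of `(A, s, ηK)` depends
only on the isomorphism class). [cite: Milne2005ShimuraVarieties, §6 Thm. 6.11 pp. 74–75]
[cite: MumfordFogartyKirwan1994, Ch. 7 §2 Definition 7.3 (p. 129) and §3 Theorem 7.9 (p. 139)] -/
theorem isAdmissibleAt_of_classifyingMap_eq (hδ : IsPolarizationType δ) {r : gspFinAdelic δ}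
    {Z : Matrix (Fin g) (Fin g) ℂ} {hZ : Z ∈ siegelUpperHalfSpace g}
    (P₀ P' : PolarizedAbelianSchemeWithLevel g N δ (specOver ℚ ℂ).left) (h₀ : IsAdmissibleAt hδ r Z hZ P₀)
    (hcls : haveI : IsLocallyNoetherian (specOver ℚ ℂ).left := inferInstanceAs (IsLocallyNoetherian (Spec (CommRingCat.of ℂ)))
      𝓜.classifyingMap (specOver ℚ ℂ) P' = 𝓜.classifyingMap (specOver ℚ ℂ) P₀) :
    IsAdmissibleAt hδ r Z hZ P' := by
  haveI : IsLocallyNoetherian (specOver ℚ ℂ).left := inferInstanceAs (IsLocallyNoetherian (Spec (CommRingCat.of ℂ)))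
  obtain ⟨H, Ĥ, hBC⟩ := 𝓜.exists_isBaseChangeVia_id_of_classifyingMap_eq P₀ P' hcls
  exact isAdmissibleAt_of_isBaseChangeVia_id' hδ hBC h₀

/-! ### §3 Every complex point of `M ⊗_ℚ ℂ` classifies a triple over `Spec ℂ` -/

/-- **Every complex point `x` of `M ⊗_ℚ ℂ` is the `ℂ`-side classifying point of a triple over `Spec ℂ` which is a pull-back of
the universal triple along the `ℚ`-side reading of `x`**: pull the universal triple back along
`s := (baseChangeEquiv …).symm x : Spec ℂ → M` (★ D-BC∃ `PolarizedAbelianSchemeWithLevel.exists_isBaseChangeVia`); that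
pull-back is classified by `s` (`classifyingMap_eq_of_isBaseChangeVia`), whose `ℂ`-side reading is `x`.  The witness `(G, Ĝ)`
is recorded (★ `W1.fiberUnivIsoOfIsBaseChangeVia` turns it into «the abelian scheme of `P′` is the fibre of the complexified
universal family over `x`»). [cite: MumfordFogartyKirwan1994, Ch. 7 §2 Definition 7.2 (p. 129) and §3 Theorem 7.9 (p. 139)] -/
theorem exists_triple_isBaseChangeVia_classifyingPoint_eq (x : ComplexPoints ((Motives.baseChange ℚ ℂ).obj 𝓜.M)) :
    haveI : IsLocallyNoetherian (specOver ℚ ℂ).left := inferInstanceAs (IsLocallyNoetherian (Spec (CommRingCat.of ℂ)))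
    ∃ (P' : PolarizedAbelianSchemeWithLevel g N δ (specOver ℚ ℂ).left)
      (G : P'.A.X.left ⟶ 𝓜.univ.A.X.left) (Ĝ : P'.D.hat.X.left ⟶ 𝓜.univ.D.hat.X.left),
      P'.IsBaseChangeVia 𝓜.univ ((AlgPoints.baseChangeEquiv (algebraMap ℚ ℂ) 𝓜.M).symm x).left G Ĝ ∧
      AlgPoints.baseChangeEquiv (algebraMap ℚ ℂ) 𝓜.M (𝓜.classifyingMap (specOver ℚ ℂ) P') = x := by
  haveI : IsLocallyNoetherian (specOver ℚ ℂ).left := inferInstanceAs (IsLocallyNoetherian (Spec (CommRingCat.of ℂ)))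
  obtain ⟨P', G, Ĝ, h⟩ := PolarizedAbelianSchemeWithLevel.exists_isBaseChangeVia 𝓜.univ
    ((AlgPoints.baseChangeEquiv (algebraMap ℚ ℂ) 𝓜.M).symm x).left
  refine ⟨P', G, Ĝ, h, ?_⟩
  rw [𝓜.classifyingMap_eq_of_isBaseChangeVia P' _ h, Equiv.apply_symm_apply]

/-- **Every triple over `Spec ℂ` is a pull-back of the universal triple along the `ℚ`-side reading of its `ℂ`-side
classifying point** (★ `exists_isBaseChangeVia_classifyingMap`, rewritten along `(baseChangeEquiv).symm ∘ baseChangeEquiv = id`: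
the hypothesis shape of ★ `W1.fiberUnivIsoOfIsBaseChangeVia` at the classifying point of `P′` itself — at `x₀ = cls P₀` the
GIVEN admissible `P₀` supplies the fibre identification). [cite: MumfordFogartyKirwan1994, Ch. 7 §3 Theorem 7.9 (p. 139)] -/
theorem exists_isBaseChangeVia_symm_classifyingPoint (P' : PolarizedAbelianSchemeWithLevel g N δ (specOver ℚ ℂ).left) :
    haveI : IsLocallyNoetherian (specOver ℚ ℂ).left := inferInstanceAs (IsLocallyNoetherian (Spec (CommRingCat.of ℂ)))
    ∃ (G : P'.A.X.left ⟶ 𝓜.univ.A.X.left) (Ĝ : P'.D.hat.X.left ⟶ 𝓜.univ.D.hat.X.left),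
      P'.IsBaseChangeVia 𝓜.univ
        ((AlgPoints.baseChangeEquiv (algebraMap ℚ ℂ) 𝓜.M).symm
          (AlgPoints.baseChangeEquiv (algebraMap ℚ ℂ) 𝓜.M (𝓜.classifyingMap (specOver ℚ ℂ) P'))).left G Ĝ := by
  haveI : IsLocallyNoetherian (specOver ℚ ℂ).left := inferInstanceAs (IsLocallyNoetherian (Spec (CommRingCat.of ℂ)))
  rw [Equiv.symm_apply_apply]
  exact 𝓜.exists_isBaseChangeVia_classifyingMap (specOver ℚ ℂ) P'

end SiegelFineModuliScheme

/-! ### §4 The socket text of the (U)-HEAD third layer, as a theorem -/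

/-- **U-e P4a — fibre triples classified by their point; admissibility is a property of the classifying point**: the text of
B-p05 (g13)'s socket `UHead.Ue_P4a_fibreTriples` VERBATIM (binder for binder), so the (U)-HEAD skeleton closes its stub by this
name: (i) `SiegelFineModuliScheme.exists_triple_isBaseChangeVia_classifyingPoint_eq`, (ii)
`SiegelFineModuliScheme.isAdmissibleAt_of_classifyingMap_eq`. [cite: MumfordFogartyKirwan1994, Ch. 7 §3 Theorem 7.9 (p. 139)]
[cite: Milne2005ShimuraVarieties, §6 Thm. 6.11 pp. 74–75] -/
theorem Ue_P4a_fibreTriples_holds :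
    ∀ (g N : ℕ) (δ : Fin g → ℕ) (_hg : 0 < g) (hδ : IsPolarizationType δ) (_hN : 3 ≤ N)
      (𝓜 : SiegelFineModuliScheme g N δ),
      haveI : IsLocallyNoetherian (specOver ℚ ℂ).left :=
        inferInstanceAs (IsLocallyNoetherian (Spec (CommRingCat.of ℂ)))
      (∀ x : ComplexPoints ((Motives.baseChange ℚ ℂ).obj 𝓜.M),
        ∃ (P' : PolarizedAbelianSchemeWithLevel g N δ (specOver ℚ ℂ).left)
          (G : P'.A.X.left ⟶ 𝓜.univ.A.X.left) (Ĝ : P'.D.hat.X.left ⟶ 𝓜.univ.D.hat.X.left),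
          P'.IsBaseChangeVia 𝓜.univ ((AlgPoints.baseChangeEquiv (algebraMap ℚ ℂ) 𝓜.M).symm x).left G Ĝ ∧
          AlgPoints.baseChangeEquiv (algebraMap ℚ ℂ) 𝓜.M (𝓜.classifyingMap (specOver ℚ ℂ) P') = x) ∧
      (∀ (r : gspFinAdelic δ) (Z : Matrix (Fin g) (Fin g) ℂ) (hZ : Z ∈ siegelUpperHalfSpace g)
        (P₀ P' : PolarizedAbelianSchemeWithLevel g N δ (specOver ℚ ℂ).left),
        IsAdmissibleAt hδ r Z hZ P₀ →
        𝓜.classifyingMap (specOver ℚ ℂ) P' = 𝓜.classifyingMap (specOver ℚ ℂ) P₀ →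
        IsAdmissibleAt hδ r Z hZ P') := by
  intro g N δ _hg hδ _hN 𝓜
  exact ⟨fun x => 𝓜.exists_triple_isBaseChangeVia_classifyingPoint_eq x,
    fun r Z hZ P₀ P' h₀ hcls => 𝓜.isAdmissibleAt_of_classifyingMap_eq hδ P₀ P' h₀ hcls⟩

end Literature.AlgebraicGeometry.ModuliOfAbelianVarieties

end
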